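import Summits.KontsevichZagierPeriods.Zeta5Search.TwoTaleRungAFirstTale

/-!
# Rung A: first-tale cells and the 7 interval theorems

HONEST FRAMING: systematic search; no irrationality claim unless certified.

Cell pub-zeta5, T3 service.  For rung A (`TwoTaleRungAFirstTale`: `a = (6n+1, 5n+1, 4n+1, 7n+1)`, `b = (1, n+1, 2n+1, 12n+2)`)
and a prime `p` with `8n < p²`: the 14 sub-cells `[u,v) ∋ {n/p}` on which ONE permutation `σ ∈ S₄` has constant first
digits and `φ_σ({n/p}) ≥ level` (`cellA_<i>_<k>`, instances of `cell_ruleA` = Zudilin 2014 Lemma 7 at rung A), assembled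
into the 7 intervals `ivlA 0, 1, 2` (level 1) and `ivlA 3, 4, 5, 6` (level 2) of fam-denom's table
`Denom/TwoTaleR3Saving.ivlA` — theorems `ivlA_<i>` with the real hypotheses `u ≤ {n/p} < v` and conclusion
`p^level ∣ formQA n ∧ p^level ∣ pAnum n` (`q_n` and `D₇ₙ² p_n`).  ALL SEVEN intervals are reached by the first tale:
no second tale, no (bmiss), no Whipple.  Witness table: HOME `code/p1/g9/rungA_cells.py` / `rungA_cells.json`.
-/

namespace Summit.KontsevichZagierPeriods.Zeta5Search.TwoTaleRungA

open TwoTaleP15 (mkPerm mod_bounds_of_fract)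
open Denom.TwoTaleR3Forms (formQA)

/-! ### Cells -/
/-- Cell `[1/7, 1/6)` ⊆ `ivlA 0` (level 1): `α' = (7, 5, 4, 6)`, `φ_σ = 1` on the cell. -/
theorem cellA_0_0 {n p : ℕ} (hn : 1 ≤ n) (hp : p.Prime) (hp2 : 8 * n < p ^ 2)
    (hu : 1 * p ≤ 7 * (n % p)) (hv : 6 * (n % p) < 1 * p) :
    (p : ℤ) ^ 1 ∣ formQA n ∧ (p : ℤ) ^ 1 ∣ pAnum n :=
  cell_ruleA (mkPerm ![3, 1, 2, 0] ![3, 1, 2, 0] (by decide) (by decide))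
    7 4 2 6 (by decide) (by decide) (by decide) (by decide) hn hp hp2 0 0 0 0 0 1 0 0
    (by omega) (by omega) (by omega) (by omega) (by omega) (by omega) (by omega) (by omega) (by norm_num)
/-- Cell `[1/5, 1/4)` ⊆ `ivlA 1` (level 1): `α' = (6, 5, 7, 4)`, `φ_σ = 1` on the cell. -/
theorem cellA_1_0 {n p : ℕ} (hn : 1 ≤ n) (hp : p.Prime) (hp2 : 8 * n < p ^ 2)
    (hu : 1 * p ≤ 5 * (n % p)) (hv : 4 * (n % p) < 1 * p) :
    (p : ℤ) ^ 1 ∣ formQA n ∧ (p : ℤ) ^ 1 ∣ pAnum n :=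
  cell_ruleA (mkPerm ![0, 1, 3, 2] ![0, 1, 3, 2] (by decide) (by decide))
    6 4 5 8 (by decide) (by decide) (by decide) (by decide) hn hp hp2 1 1 0 0 1 1 0 1
    (by omega) (by omega) (by omega) (by omega) (by omega) (by omega) (by omega) (by omega) (by norm_num)
/-- Cell `[1/4, 1/3)` ⊆ `ivlA 1` (level 1): `α' = (4, 5, 6, 7)`, `φ_σ = 1` on the cell. -/
theorem cellA_1_1 {n p : ℕ} (hn : 1 ≤ n) (hp : p.Prime) (hp2 : 8 * n < p ^ 2)
    (hu : 1 * p ≤ 4 * (n % p)) (hv : 3 * (n % p) < 1 * p) :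
    (p : ℤ) ^ 1 ∣ formQA n ∧ (p : ℤ) ^ 1 ∣ pAnum n :=
  cell_ruleA (mkPerm ![2, 1, 0, 3] ![2, 1, 0, 3] (by decide) (by decide))
    4 4 4 5 (by decide) (by decide) (by decide) (by decide) hn hp hp2 1 1 1 0 1 1 1 1
    (by omega) (by omega) (by omega) (by omega) (by omega) (by omega) (by omega) (by omega) (by norm_num)
/-- Cell `[1/3, 2/5)` ⊆ `ivlA 1` (level 1): `α' = (6, 4, 5, 7)`, `φ_σ = 1` on the cell. -/
theorem cellA_1_2 {n p : ℕ} (hn : 1 ≤ n) (hp : p.Prime) (hp2 : 8 * n < p ^ 2)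
    (hu : 1 * p ≤ 3 * (n % p)) (hv : 5 * (n % p) < 2 * p) :
    (p : ℤ) ^ 1 ∣ formQA n ∧ (p : ℤ) ^ 1 ∣ pAnum n :=
  cell_ruleA (mkPerm ![0, 2, 1, 3] ![0, 2, 1, 3] (by decide) (by decide))
    6 3 3 5 (by decide) (by decide) (by decide) (by decide) hn hp hp2 1 2 1 0 1 2 1 1
    (by omega) (by omega) (by omega) (by omega) (by omega) (by omega) (by omega) (by omega) (by norm_num)
/-- Cell `[2/5, 1/2)` ⊆ `ivlA 1` (level 1): `α' = (6, 5, 7, 4)`, `φ_σ = 1` on the cell. -/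
theorem cellA_1_3 {n p : ℕ} (hn : 1 ≤ n) (hp : p.Prime) (hp2 : 8 * n < p ^ 2)
    (hu : 2 * p ≤ 5 * (n % p)) (hv : 2 * (n % p) < 1 * p) :
    (p : ℤ) ^ 1 ∣ formQA n ∧ (p : ℤ) ^ 1 ∣ pAnum n :=
  cell_ruleA (mkPerm ![0, 1, 3, 2] ![0, 1, 3, 2] (by decide) (by decide))
    6 4 5 8 (by decide) (by decide) (by decide) (by decide) hn hp hp2 2 2 1 0 3 2 1 2
    (by omega) (by omega) (by omega) (by omega) (by omega) (by omega) (by omega) (by omega) (by norm_num)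
/-- Cell `[3/5, 2/3)` ⊆ `ivlA 2` (level 1): `α' = (5, 6, 4, 7)`, `φ_σ = 1` on the cell. -/
theorem cellA_2_0 {n p : ℕ} (hn : 1 ≤ n) (hp : p.Prime) (hp2 : 8 * n < p ^ 2)
    (hu : 3 * p ≤ 5 * (n % p)) (hv : 3 * (n % p) < 2 * p) :
    (p : ℤ) ^ 1 ∣ formQA n ∧ (p : ℤ) ^ 1 ∣ pAnum n :=
  cell_ruleA (mkPerm ![1, 0, 2, 3] ![1, 0, 2, 3] (by decide) (by decide))
    5 5 2 5 (by decide) (by decide) (by decide) (by decide) hn hp hp2 3 3 2 1 3 3 3 1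
    (by omega) (by omega) (by omega) (by omega) (by omega) (by omega) (by omega) (by omega) (by norm_num)
/-- Cell `[2/3, 3/4)` ⊆ `ivlA 2` (level 1): `α' = (6, 4, 5, 7)`, `φ_σ = 1` on the cell. -/
theorem cellA_2_1 {n p : ℕ} (hn : 1 ≤ n) (hp : p.Prime) (hp2 : 8 * n < p ^ 2)
    (hu : 2 * p ≤ 3 * (n % p)) (hv : 4 * (n % p) < 3 * p) :
    (p : ℤ) ^ 1 ∣ formQA n ∧ (p : ℤ) ^ 1 ∣ pAnum n :=
  cell_ruleA (mkPerm ![0, 2, 1, 3] ![0, 2, 1, 3] (by decide) (by decide))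
    6 3 3 5 (by decide) (by decide) (by decide) (by decide) hn hp hp2 3 4 2 1 3 4 2 2
    (by omega) (by omega) (by omega) (by omega) (by omega) (by omega) (by omega) (by omega) (by norm_num)
/-- Cell `[3/4, 4/5)` ⊆ `ivlA 2` (level 1): `α' = (4, 5, 6, 7)`, `φ_σ = 1` on the cell. -/
theorem cellA_2_2 {n p : ℕ} (hn : 1 ≤ n) (hp : p.Prime) (hp2 : 8 * n < p ^ 2)
    (hu : 3 * p ≤ 4 * (n % p)) (hv : 5 * (n % p) < 4 * p) :
    (p : ℤ) ^ 1 ∣ formQA n ∧ (p : ℤ) ^ 1 ∣ pAnum n :=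
  cell_ruleA (mkPerm ![2, 1, 0, 3] ![2, 1, 0, 3] (by decide) (by decide))
    4 4 4 5 (by decide) (by decide) (by decide) (by decide) hn hp hp2 3 4 3 1 3 3 3 3
    (by omega) (by omega) (by omega) (by omega) (by omega) (by omega) (by omega) (by omega) (by norm_num)
/-- Cell `[4/5, 5/6)` ⊆ `ivlA 2` (level 1): `α' = (6, 5, 7, 4)`, `φ_σ = 1` on the cell. -/
theorem cellA_2_3 {n p : ℕ} (hn : 1 ≤ n) (hp : p.Prime) (hp2 : 8 * n < p ^ 2)
    (hu : 4 * p ≤ 5 * (n % p)) (hv : 6 * (n % p) < 5 * p) :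
    (p : ℤ) ^ 1 ∣ formQA n ∧ (p : ℤ) ^ 1 ∣ pAnum n :=
  cell_ruleA (mkPerm ![0, 1, 3, 2] ![0, 1, 3, 2] (by decide) (by decide))
    6 4 5 8 (by decide) (by decide) (by decide) (by decide) hn hp hp2 4 4 3 1 6 4 3 4
    (by omega) (by omega) (by omega) (by omega) (by omega) (by omega) (by omega) (by omega) (by norm_num)
/-- Cell `[5/6, 7/8)` ⊆ `ivlA 2` (level 1): `α' = (6, 5, 7, 4)`, `φ_σ = 1` on the cell. -/
theorem cellA_2_4 {n p : ℕ} (hn : 1 ≤ n) (hp : p.Prime) (hp2 : 8 * n < p ^ 2)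
    (hu : 5 * p ≤ 6 * (n % p)) (hv : 8 * (n % p) < 7 * p) :
    (p : ℤ) ^ 1 ∣ formQA n ∧ (p : ℤ) ^ 1 ∣ pAnum n :=
  cell_ruleA (mkPerm ![0, 1, 3, 2] ![0, 1, 3, 2] (by decide) (by decide))
    6 4 5 8 (by decide) (by decide) (by decide) (by decide) hn hp hp2 4 5 3 1 6 5 3 4
    (by omega) (by omega) (by omega) (by omega) (by omega) (by omega) (by omega) (by omega) (by norm_num)
/-- Cell `[1/5, 1/4)` ⊆ `ivlA 3` (level 2): `α' = (5, 6, 7, 4)`, `φ_σ = 2` on the cell. -/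
theorem cellA_3_0 {n p : ℕ} (hn : 1 ≤ n) (hp : p.Prime) (hp2 : 8 * n < p ^ 2)
    (hu : 1 * p ≤ 5 * (n % p)) (hv : 4 * (n % p) < 1 * p) :
    (p : ℤ) ^ 2 ∣ formQA n ∧ (p : ℤ) ^ 2 ∣ pAnum n :=
  cell_ruleA (mkPerm ![1, 0, 3, 2] ![1, 0, 3, 2] (by decide) (by decide))
    5 5 5 8 (by decide) (by decide) (by decide) (by decide) hn hp hp2 1 1 0 0 1 1 1 1
    (by omega) (by omega) (by omega) (by omega) (by omega) (by omega) (by omega) (by omega) (by norm_num)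
/-- Cell `[2/5, 1/2)` ⊆ `ivlA 4` (level 2): `α' = (5, 6, 7, 4)`, `φ_σ = 2` on the cell. -/
theorem cellA_4_0 {n p : ℕ} (hn : 1 ≤ n) (hp : p.Prime) (hp2 : 8 * n < p ^ 2)
    (hu : 2 * p ≤ 5 * (n % p)) (hv : 2 * (n % p) < 1 * p) :
    (p : ℤ) ^ 2 ∣ formQA n ∧ (p : ℤ) ^ 2 ∣ pAnum n :=
  cell_ruleA (mkPerm ![1, 0, 3, 2] ![1, 0, 3, 2] (by decide) (by decide))
    5 5 5 8 (by decide) (by decide) (by decide) (by decide) hn hp hp2 2 2 1 0 3 2 2 2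
    (by omega) (by omega) (by omega) (by omega) (by omega) (by omega) (by omega) (by omega) (by norm_num)
/-- Cell `[3/5, 5/8)` ⊆ `ivlA 5` (level 2): `α' = (5, 6, 7, 4)`, `φ_σ = 2` on the cell. -/
theorem cellA_5_0 {n p : ℕ} (hn : 1 ≤ n) (hp : p.Prime) (hp2 : 8 * n < p ^ 2)
    (hu : 3 * p ≤ 5 * (n % p)) (hv : 8 * (n % p) < 5 * p) :
    (p : ℤ) ^ 2 ∣ formQA n ∧ (p : ℤ) ^ 2 ∣ pAnum n :=
  cell_ruleA (mkPerm ![1, 0, 3, 2] ![1, 0, 3, 2] (by decide) (by decide))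
    5 5 5 8 (by decide) (by decide) (by decide) (by decide) hn hp hp2 3 3 2 1 4 3 3 3
    (by omega) (by omega) (by omega) (by omega) (by omega) (by omega) (by omega) (by omega) (by norm_num)
/-- Cell `[4/5, 5/6)` ⊆ `ivlA 6` (level 2): `α' = (5, 6, 7, 4)`, `φ_σ = 2` on the cell. -/
theorem cellA_6_0 {n p : ℕ} (hn : 1 ≤ n) (hp : p.Prime) (hp2 : 8 * n < p ^ 2)
    (hu : 4 * p ≤ 5 * (n % p)) (hv : 6 * (n % p) < 5 * p) :
    (p : ℤ) ^ 2 ∣ formQA n ∧ (p : ℤ) ^ 2 ∣ pAnum n :=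
  cell_ruleA (mkPerm ![1, 0, 3, 2] ![1, 0, 3, 2] (by decide) (by decide))
    5 5 5 8 (by decide) (by decide) (by decide) (by decide) hn hp hp2 4 4 3 1 6 4 4 4
    (by omega) (by omega) (by omega) (by omega) (by omega) (by omega) (by omega) (by omega) (by norm_num)
/-! ### Assembly into fam-denom's intervals -/
/-- **Interval `[1/7, 1/6)`** (`ivlA 0`, level 1): for every prime `p` with `8n < p²` and `{n/p} ∈ [1/7, 1/6)`, `p^1 ∣ q_n` and `p^1 ∣ D₇ₙ² p_n` (first tale alone). -/
theorem ivlA_0 {n p : ℕ} (hn : 1 ≤ n) (hp : p.Prime) (hp2 : 8 * n < p ^ 2)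
    (h1 : (1 / 7 : ℝ) ≤ Int.fract ((n : ℝ) / p)) (h2 : Int.fract ((n : ℝ) / p) < 1 / 6) :
    (p : ℤ) ^ 1 ∣ formQA n ∧ (p : ℤ) ^ 1 ∣ pAnum n := by
  obtain ⟨hu, hv⟩ := mod_bounds_of_fract (U₁ := 1) (U₂ := 7) (V₁ := 1) (V₂ := 6) hp.pos
    (by norm_num) (by norm_num) (by exact_mod_cast h1) (by exact_mod_cast h2)
  exact cellA_0_0 hn hp hp2 hu hv

/-- **Interval `[1/5, 1/2)`** (`ivlA 1`, level 1): for every prime `p` with `8n < p²` and `{n/p} ∈ [1/5, 1/2)`, `p^1 ∣ q_n` and `p^1 ∣ D₇ₙ² p_n` (first tale alone). -/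
theorem ivlA_1 {n p : ℕ} (hn : 1 ≤ n) (hp : p.Prime) (hp2 : 8 * n < p ^ 2)
    (h1 : (1 / 5 : ℝ) ≤ Int.fract ((n : ℝ) / p)) (h2 : Int.fract ((n : ℝ) / p) < 1 / 2) :
    (p : ℤ) ^ 1 ∣ formQA n ∧ (p : ℤ) ^ 1 ∣ pAnum n := by
  obtain ⟨hu, hv⟩ := mod_bounds_of_fract (U₁ := 1) (U₂ := 5) (V₁ := 1) (V₂ := 2) hp.pos
    (by norm_num) (by norm_num) (by exact_mod_cast h1) (by exact_mod_cast h2)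
  by_cases b0 : 4 * (n % p) < 1 * p
  · exact cellA_1_0 hn hp hp2 hu b0
  · by_cases b1 : 3 * (n % p) < 1 * p
    · exact cellA_1_1 hn hp hp2 (by omega) b1
    · by_cases b2 : 5 * (n % p) < 2 * p
      · exact cellA_1_2 hn hp hp2 (by omega) b2
      · exact cellA_1_3 hn hp hp2 (by omega) hv

/-- **Interval `[3/5, 7/8)`** (`ivlA 2`, level 1): for every prime `p` with `8n < p²` and `{n/p} ∈ [3/5, 7/8)`, `p^1 ∣ q_n` and `p^1 ∣ D₇ₙ² p_n` (first tale alone). -/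
theorem ivlA_2 {n p : ℕ} (hn : 1 ≤ n) (hp : p.Prime) (hp2 : 8 * n < p ^ 2)
    (h1 : (3 / 5 : ℝ) ≤ Int.fract ((n : ℝ) / p)) (h2 : Int.fract ((n : ℝ) / p) < 7 / 8) :
    (p : ℤ) ^ 1 ∣ formQA n ∧ (p : ℤ) ^ 1 ∣ pAnum n := by
  obtain ⟨hu, hv⟩ := mod_bounds_of_fract (U₁ := 3) (U₂ := 5) (V₁ := 7) (V₂ := 8) hp.pos
    (by norm_num) (by norm_num) (by exact_mod_cast h1) (by exact_mod_cast h2)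
  by_cases b0 : 3 * (n % p) < 2 * p
  · exact cellA_2_0 hn hp hp2 hu b0
  · by_cases b1 : 4 * (n % p) < 3 * p
    · exact cellA_2_1 hn hp hp2 (by omega) b1
    · by_cases b2 : 5 * (n % p) < 4 * p
      · exact cellA_2_2 hn hp hp2 (by omega) b2
      · by_cases b3 : 6 * (n % p) < 5 * p
        · exact cellA_2_3 hn hp hp2 (by omega) b3
        · exact cellA_2_4 hn hp hp2 (by omega) hv

/-- **Interval `[1/5, 1/4)`** (`ivlA 3`, level 2): for every prime `p` with `8n < p²` and `{n/p} ∈ [1/5, 1/4)`, `p^2 ∣ q_n` and `p^2 ∣ D₇ₙ² p_n` (first tale alone). -/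
theorem ivlA_3 {n p : ℕ} (hn : 1 ≤ n) (hp : p.Prime) (hp2 : 8 * n < p ^ 2)
    (h1 : (1 / 5 : ℝ) ≤ Int.fract ((n : ℝ) / p)) (h2 : Int.fract ((n : ℝ) / p) < 1 / 4) :
    (p : ℤ) ^ 2 ∣ formQA n ∧ (p : ℤ) ^ 2 ∣ pAnum n := by
  obtain ⟨hu, hv⟩ := mod_bounds_of_fract (U₁ := 1) (U₂ := 5) (V₁ := 1) (V₂ := 4) hp.pos
    (by norm_num) (by norm_num) (by exact_mod_cast h1) (by exact_mod_cast h2)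
  exact cellA_3_0 hn hp hp2 hu hv

/-- **Interval `[2/5, 1/2)`** (`ivlA 4`, level 2): for every prime `p` with `8n < p²` and `{n/p} ∈ [2/5, 1/2)`, `p^2 ∣ q_n` and `p^2 ∣ D₇ₙ² p_n` (first tale alone). -/
theorem ivlA_4 {n p : ℕ} (hn : 1 ≤ n) (hp : p.Prime) (hp2 : 8 * n < p ^ 2)
    (h1 : (2 / 5 : ℝ) ≤ Int.fract ((n : ℝ) / p)) (h2 : Int.fract ((n : ℝ) / p) < 1 / 2) :
    (p : ℤ) ^ 2 ∣ formQA n ∧ (p : ℤ) ^ 2 ∣ pAnum n := by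
  obtain ⟨hu, hv⟩ := mod_bounds_of_fract (U₁ := 2) (U₂ := 5) (V₁ := 1) (V₂ := 2) hp.pos
    (by norm_num) (by norm_num) (by exact_mod_cast h1) (by exact_mod_cast h2)
  exact cellA_4_0 hn hp hp2 hu hv

/-- **Interval `[3/5, 5/8)`** (`ivlA 5`, level 2): for every prime `p` with `8n < p²` and `{n/p} ∈ [3/5, 5/8)`, `p^2 ∣ q_n` and `p^2 ∣ D₇ₙ² p_n` (first tale alone). -/
theorem ivlA_5 {n p : ℕ} (hn : 1 ≤ n) (hp : p.Prime) (hp2 : 8 * n < p ^ 2)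
    (h1 : (3 / 5 : ℝ) ≤ Int.fract ((n : ℝ) / p)) (h2 : Int.fract ((n : ℝ) / p) < 5 / 8) :
    (p : ℤ) ^ 2 ∣ formQA n ∧ (p : ℤ) ^ 2 ∣ pAnum n := by
  obtain ⟨hu, hv⟩ := mod_bounds_of_fract (U₁ := 3) (U₂ := 5) (V₁ := 5) (V₂ := 8) hp.pos
    (by norm_num) (by norm_num) (by exact_mod_cast h1) (by exact_mod_cast h2)
  exact cellA_5_0 hn hp hp2 hu hv

/-- **Interval `[4/5, 5/6)`** (`ivlA 6`, level 2): for every prime `p` with `8n < p²` and `{n/p} ∈ [4/5, 5/6)`, `p^2 ∣ q_n` and `p^2 ∣ D₇ₙ² p_n` (first tale alone). -/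
theorem ivlA_6 {n p : ℕ} (hn : 1 ≤ n) (hp : p.Prime) (hp2 : 8 * n < p ^ 2)
    (h1 : (4 / 5 : ℝ) ≤ Int.fract ((n : ℝ) / p)) (h2 : Int.fract ((n : ℝ) / p) < 5 / 6) :
    (p : ℤ) ^ 2 ∣ formQA n ∧ (p : ℤ) ^ 2 ∣ pAnum n := by
  obtain ⟨hu, hv⟩ := mod_bounds_of_fract (U₁ := 4) (U₂ := 5) (V₁ := 5) (V₂ := 6) hp.pos
    (by norm_num) (by norm_num) (by exact_mod_cast h1) (by exact_mod_cast h2)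
  exact cellA_6_0 hn hp hp2 hu hv

end Summit.KontsevichZagierPeriods.Zeta5Search.TwoTaleRungA
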